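import Mathlib
import HarnessLib.Audit

/-!
# LEMMA α: a one-carrier P⋆-shaped function constant on a level set of a disjoint AND-sum (E1 / `CoupledThreeG`, one-carrier coupling; prover-1 g18)

FRONTIER range-avoidance ladder, rung F-N3 (`stmt-PneNP-19007`), cell `pnp-ideate` (planner p3 g23, `HOME/pnp-ideate-p3/r25/SketchLemmaAlpha.lean`,
memo `r24/CORE-BOUND-NOTES.md` §14.42–14.43, checker `r25/lemma_alpha_check.py`); restricted-model proof complexity — nothing here bears on `P` versus `NP`.

Abstract cube model (genre of `PstarGateHyperplane`): `k` monomials `m i = x (p i) * x (q i)` on pairwise distinct variables, `M x = Σ i, m i x`.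
A ONE-CARRIER P⋆-shaped function on these variables is `F x = c + Σ_{i ∈ S'} m i x + Σ_{w ∈ Λ} x w + [carrier] x a * x b` with `Λ` and the
carrier inside the `2k` variables and the carrier pair not one of the monomials.  **LEMMA α** (`LemmaAlpha`, the statement VERBATIM from the planner's
sketch, there exhaustively checked for `k ≤ 4`): if `F` is constant on a non-empty level set `{M = v}` then `F` is `c` or `M + c` as polynomial data, or
`k = 2`, `v = 1` and the linear part + carrier is the OR-gate `x a * x b + x a + x b` on one variable of each monomial, or `k = 1`, `v = 1`.

* `lemmaAlpha_holds : LemmaAlpha` — PROVED here.  Proof: `M`-preserving FLIPS.  Flipping a variable `w` whose monomial partner is dark keeps the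
  level set and changes `F` by `[w ∈ Λ] + [a = w] x b + [b = w] x a` (`key`).  `v = 0`: flips at `0` empty `Λ`, the flip of `a` at `e_b` kills the
  carrier, and the point lighting one monomial of `S'` and one outside it breaks constancy.  `v = 1`, no carrier: flip `w` at a point lighting another
  monomial.  `v = 1` with carrier `a ∈ mᵢ`, `b ∈ mⱼ` (`i ≠ j` since the carrier is not a monomial): the flip of `a` at "`mⱼ` lit" puts `a ∈ Λ`, the
  same flip at a third lit monomial takes it out (so `k = 2`), and then the co-variables are flipped out of `Λ` and the two lit points equalise `S'`.
This is the finite heart of the one-carrier coupling classification for `CoupledThreeG` (K25 census, `r25/coupledW.py`).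
-/

set_option linter.dupNamespace false -- `Summit.PneNP.PneNP.…`: summit = sub-problem name (D-0017 single-conjunct layout)

namespace Summit.PneNP.PneNP.Theorems.PstarLemmaAlpha

open Finset

variable {N k : ℕ}

/-- the AND-sum of the `k` disjoint monomials -/
def msum (p q : Fin k → Fin N) (x : Fin N → ZMod 2) : ZMod 2 := ∑ i, x (p i) * x (q i)

/-- a one-carrier P⋆-shaped function on the monomials' variables: constant + sub-sum + linear part + optional carrier -/
def pshape (p q : Fin k → Fin N) (c : ZMod 2) (S' : Finset (Fin k)) (Λ : Finset (Fin N)) (g : Option (Fin N × Fin N))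
    (x : Fin N → ZMod 2) : ZMod 2 :=
  c + (∑ i ∈ S', x (p i) * x (q i)) + (∑ w ∈ Λ, x w) + (match g with | none => 0 | some (a, b) => x a * x b)

/-- the variables of the monomials -/
def mvars (p q : Fin k → Fin N) : Finset (Fin N) := univ.image p ∪ univ.image q

/-- **LEMMA α** (planner p3's statement, verbatim). -/
def LemmaAlpha : Prop :=
  ∀ (N k : ℕ) (p q : Fin k → Fin N), Function.Injective p → Function.Injective q → (∀ i j, p i ≠ q j) →
  ∀ (c v : ZMod 2) (S' : Finset (Fin k)) (Λ : Finset (Fin N)) (g : Option (Fin N × Fin N)),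
    Λ ⊆ mvars p q →
    (∀ a b, g = some (a, b) → a ∈ mvars p q ∧ b ∈ mvars p q ∧ a ≠ b ∧ ∀ i, ¬ ({a, b} : Finset (Fin N)) = {p i, q i}) →
    (∃ x : Fin N → ZMod 2, msum p q x = v) →
    (∃ κ : ZMod 2, ∀ x : Fin N → ZMod 2, msum p q x = v → pshape p q c S' Λ g x = κ) →
      (Λ = ∅ ∧ g = none ∧ (S' = ∅ ∨ S' = univ)) ∨
      (k = 2 ∧ v = 1 ∧ (S' = ∅ ∨ S' = univ) ∧ ∃ a b, g = some (a, b) ∧ Λ = {a, b} ∧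
          ∃ i j, i ≠ j ∧ (a = p i ∨ a = q i) ∧ (b = p j ∨ b = q j)) ∨
      (k = 1 ∧ v = 1)

/-! ## Flip calculus -/

/-- the carrier's value -/
def cval (g : Option (Fin N × Fin N)) (x : Fin N → ZMod 2) : ZMod 2 :=
  match g with | none => 0 | some (a, b) => x a * x b

/-- the carrier's change under the flip of `w` -/
def cflip (g : Option (Fin N × Fin N)) (w : Fin N) (x : Fin N → ZMod 2) : ZMod 2 :=
  match g with | none => 0 | some (a, b) => (if a = w then x b else 0) + (if b = w then x a else 0)

/-- `pshape` with the carrier written as `cval`. -/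
theorem pshape_eq (p q : Fin k → Fin N) (c : ZMod 2) (S' : Finset (Fin k)) (Λ : Finset (Fin N)) (g : Option (Fin N × Fin N))
    (x : Fin N → ZMod 2) : pshape p q c S' Λ g x = c + (∑ i ∈ S', x (p i) * x (q i)) + (∑ w ∈ Λ, x w) + cval g x := by
  rcases g with _ | ⟨a, b⟩ <;> rfl

/-- Coordinates of the flipped point. -/
theorem flip_apply (x : Fin N → ZMod 2) (w v : Fin N) : (x + Pi.single w 1 : Fin N → ZMod 2) v = x v + if v = w then 1 else 0 := by
  rw [Pi.add_apply]; by_cases h : v = w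
  · rw [h, Pi.single_eq_same, if_pos rfl]
  · rw [Pi.single_eq_of_ne h, if_neg h]

/-- A monomial whose partner variable is dark does not feel the flip. -/
theorem term_flip (p q : Fin k → Fin N) (hpq : ∀ i j, p i ≠ q j) {x : Fin N → ZMod 2} {w : Fin N} (i : Fin k)
    (hdark : (p i = w → x (q i) = 0) ∧ (q i = w → x (p i) = 0)) :
    (x + Pi.single w 1 : Fin N → ZMod 2) (p i) * (x + Pi.single w 1 : Fin N → ZMod 2) (q i) = x (p i) * x (q i) := by
  rw [flip_apply, flip_apply]
  by_cases h1 : p i = w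
  · have h2 : q i ≠ w := fun h => hpq i i (h1.trans h.symm)
    rw [if_pos h1, if_neg h2, hdark.1 h1]; ring
  · by_cases h2 : q i = w
    · rw [if_neg h1, if_pos h2, hdark.2 h2]; ring
    · rw [if_neg h1, if_neg h2]; ring

/-- The AND-sum is invariant under a dark-partner flip. -/
theorem msum_flip (p q : Fin k → Fin N) (hpq : ∀ i j, p i ≠ q j) {x : Fin N → ZMod 2} {w : Fin N}
    (hdark : ∀ i, (p i = w → x (q i) = 0) ∧ (q i = w → x (p i) = 0)) : msum p q (x + Pi.single w 1) = msum p q x := by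
  unfold msum
  exact sum_congr rfl fun i _ => term_flip p q hpq i (hdark i)

/-- The carrier's change under a flip. -/
theorem cval_flip {g : Option (Fin N × Fin N)} (hg : ∀ a b, g = some (a, b) → a ≠ b) (x : Fin N → ZMod 2) (w : Fin N) :
    cval g (x + Pi.single w 1) = cval g x + cflip g w x := by
  rcases g with _ | ⟨a, b⟩
  · simp only [cval, cflip, add_zero]
  · have hab : a ≠ b := hg a b rfl
    simp only [cval, cflip]
    rw [flip_apply, flip_apply]
    by_cases ha : a = w
    · have hb : b ≠ w := fun h => hab (ha.trans h.symm)
      rw [if_pos ha, if_neg hb, if_pos ha, if_neg hb]; ring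
    · by_cases hb : b = w
      · rw [if_neg ha, if_pos hb, if_neg ha, if_pos hb]; ring
      · rw [if_neg ha, if_neg hb, if_neg ha, if_neg hb]; ring

/-- **Flip formula**: under a dark-partner flip of `w`, `F` changes by `[w ∈ Λ] + [a = w] x b + [b = w] x a`. -/
theorem pshape_flip (p q : Fin k → Fin N) (hpq : ∀ i j, p i ≠ q j) (c : ZMod 2) (S' : Finset (Fin k)) (Λ : Finset (Fin N))
    {g : Option (Fin N × Fin N)} (hg : ∀ a b, g = some (a, b) → a ≠ b) {x : Fin N → ZMod 2} {w : Fin N}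
    (hdark : ∀ i, (p i = w → x (q i) = 0) ∧ (q i = w → x (p i) = 0)) :
    pshape p q c S' Λ g (x + Pi.single w 1) = pshape p q c S' Λ g x + (if w ∈ Λ then 1 else 0) + cflip g w x := by
  classical
  have hS : ∑ i ∈ S', (x + Pi.single w 1 : Fin N → ZMod 2) (p i) * (x + Pi.single w 1 : Fin N → ZMod 2) (q i) =
      ∑ i ∈ S', x (p i) * x (q i) := sum_congr rfl fun i _ => term_flip p q hpq i (hdark i)
  have hΛ : ∑ w' ∈ Λ, (x + Pi.single w 1 : Fin N → ZMod 2) w' = (∑ w' ∈ Λ, x w') + if w ∈ Λ then 1 else 0 := by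
    rw [sum_congr rfl fun w' _ => flip_apply x w w', sum_add_distrib, sum_ite_eq' Λ w]
  rw [pshape_eq, pshape_eq, cval_flip hg, hS, hΛ]; ring

/-! ## The lit-monomial points -/

/-- the point lighting monomial `j` only -/
def pt (p q : Fin k → Fin N) (j : Fin k) : Fin N → ZMod 2 := fun w => if w = p j ∨ w = q j then 1 else 0

/-- The lit monomial's variables are `1` at `pt j`. -/
theorem pt_of_mem (p q : Fin k → Fin N) {j : Fin k} {w : Fin N} (h : w = p j ∨ w = q j) : pt p q j w = 1 := if_pos h

/-- Every other variable is `0` at `pt j`. -/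
theorem pt_of_not_mem (p q : Fin k → Fin N) {j : Fin k} {w : Fin N} (h : ¬ (w = p j ∨ w = q j)) : pt p q j w = 0 := if_neg h

/-- A variable of monomial `i ≠ j` is dark at `pt j`. -/
theorem not_mem_of_ne {p q : Fin k → Fin N} (hp : Function.Injective p) (hq : Function.Injective q) (hpq : ∀ i j, p i ≠ q j) {i j : Fin k}
    (hij : i ≠ j) {w : Fin N} (hw : w = p i ∨ w = q i) : ¬ (w = p j ∨ w = q j) := by
  rintro (h | h) <;> rcases hw with rfl | rfl
  exacts [hij (hp h), hpq j i h.symm, hpq i j h, hij (hq h)]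

/-- `pt j` lies on the level set `{M = 1}`. -/
theorem msum_pt {p q : Fin k → Fin N} (hp : Function.Injective p) (hpq : ∀ i j, p i ≠ q j) (j : Fin k) : msum p q (pt p q j) = 1 := by
  unfold msum
  rw [Finset.sum_eq_single j]
  · rw [pt_of_mem p q (Or.inl rfl), pt_of_mem p q (Or.inr rfl), one_mul]
  · intro i _ hij
    rw [pt_of_not_mem p q (w := p i) (by rintro (h | h); exacts [hij (hp h), hpq i j h]), zero_mul]
  · intro h; exact absurd (mem_univ j) h

/-- The sub-sum at `pt j` is `[j ∈ S']`. -/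
theorem sumS_pt {p q : Fin k → Fin N} (hp : Function.Injective p) (hpq : ∀ i j, p i ≠ q j) (S' : Finset (Fin k)) (j : Fin k) :
    ∑ i ∈ S', pt p q j (p i) * pt p q j (q i) = if j ∈ S' then 1 else 0 := by
  classical
  have hterm : ∀ i, i ≠ j → pt p q j (p i) * pt p q j (q i) = 0 := fun i hij => by
    rw [pt_of_not_mem p q (w := p i) (by rintro (h | h); exacts [hij (hp h), hpq i j h]), zero_mul]
  split_ifs with hj
  · rw [Finset.sum_eq_single_of_mem j hj fun i _ hij => hterm i hij, pt_of_mem p q (Or.inl rfl), pt_of_mem p q (Or.inr rfl), one_mul]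
  · exact Finset.sum_eq_zero fun i hi => hterm i fun h => hj (h ▸ hi)

/-- Darkness at `pt j` of the partner of any `w` outside monomial `j`. -/
theorem dark_pt {p q : Fin k → Fin N} (hq : Function.Injective q) (hp : Function.Injective p) (hpq : ∀ i j, p i ≠ q j) (j : Fin k) {w : Fin N}
    (hw : ¬ (w = p j ∨ w = q j)) : ∀ i, (p i = w → pt p q j (q i) = 0) ∧ (q i = w → pt p q j (p i) = 0) := by
  intro i
  constructor
  · intro h
    refine pt_of_not_mem p q ?_
    rintro (h' | h'); exacts [hpq j i h'.symm, hw (Or.inl (by rw [← h, hq h']))]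
  · intro h
    refine pt_of_not_mem p q ?_
    rintro (h' | h'); exacts [hw (Or.inr (by rw [← h, hp h'])), hpq i j h']

/-- `S' = ∅ ∨ S' = univ` from pairwise equivalence of membership. -/
theorem empty_or_univ {S' : Finset (Fin k)} (h : ∀ i j, i ∈ S' → j ∈ S') : S' = ∅ ∨ S' = univ := by
  by_cases h0 : S' = ∅
  · exact Or.inl h0
  · obtain ⟨i, hi⟩ := nonempty_iff_ne_empty.2 h0
    exact Or.inr (eq_univ_of_forall fun j => h i j hi)

/-! ## LEMMA α -/

/-- **LEMMA α holds.** -/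
theorem lemmaAlpha_holds : LemmaAlpha := by
  intro N k p q hp hq hpq c v S' Λ g hΛ hg hZ hconst
  classical
  obtain ⟨x₀, hx₀⟩ := hZ
  obtain ⟨κ, hκ⟩ := hconst
  have hgne : ∀ a b, g = some (a, b) → a ≠ b := fun a b h => (hg a b h).2.2.1
  -- the flip principle
  have key : ∀ (x : Fin N → ZMod 2) (w : Fin N), msum p q x = v → (∀ i, (p i = w → x (q i) = 0) ∧ (q i = w → x (p i) = 0)) →
      (if w ∈ Λ then (1 : ZMod 2) else 0) + cflip g w x = 0 := by
    intro x w hx hdark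
    have h1 := hκ x hx
    have h2 := hκ (x + Pi.single w 1) (by rw [msum_flip p q hpq hdark]; exact hx)
    rw [pshape_flip p q hpq c S' Λ hgne hdark, h1, add_assoc] at h2
    exact add_eq_left.1 h2
  -- membership in `mvars`
  have hmv : ∀ {w}, w ∈ mvars p q → ∃ i, w = p i ∨ w = q i := fun {w} hw => by
    rcases mem_union.1 hw with h | h <;> obtain ⟨i, -, hi⟩ := mem_image.1 h
    exacts [⟨i, Or.inl hi.symm⟩, ⟨i, Or.inr hi.symm⟩]
  have hv : ∀ t : ZMod 2, t = 0 ∨ t = 1 := by decide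
  rcases hv v with rfl | rfl
  · ------------------------------------------------------------------ v = 0
    left
    have hms0 : msum p q 0 = 0 := by unfold msum; simp
    have hΛ0 : Λ = ∅ := by
      refine eq_empty_of_forall_notMem fun w hw => ?_
      have h := key 0 w hms0 (fun i => ⟨fun _ => rfl, fun _ => rfl⟩)
      have hc : cflip g w 0 = 0 := by rcases g with _ | ⟨a, b⟩ <;> simp [cflip]
      rw [if_pos hw, hc, add_zero] at h
      exact one_ne_zero h
    have hg0 : g = none := by
      rcases hg' : g with _ | ⟨a, b⟩
      · rfl
      · exfalso
        obtain ⟨-, -, hab, hmon⟩ := hg a b hg'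
        -- flip `a` at `e_b`
        have hxb : msum p q (0 + Pi.single b 1) = 0 := by
          rw [msum_flip p q hpq (fun i => ⟨fun _ => rfl, fun _ => rfl⟩)]; exact hms0
        have hdark : ∀ i, (p i = a → (0 + Pi.single b 1 : Fin N → ZMod 2) (q i) = 0) ∧
            (q i = a → (0 + Pi.single b 1 : Fin N → ZMod 2) (p i) = 0) := fun i =>
          ⟨fun h => by rw [zero_add, Pi.single_eq_of_ne]; exact fun h' => hmon i (by rw [← h, ← h']),
           fun h => by rw [zero_add, Pi.single_eq_of_ne]; exact fun h' => hmon i (by rw [← h, ← h', pair_comm])⟩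
        have h := key _ a hxb hdark
        rw [hg'] at h
        simp only [cflip, zero_add, Pi.single_eq_same, hΛ0, notMem_empty, if_false] at h
        rw [if_neg (Ne.symm hab)] at h
        norm_num at h
    refine ⟨hΛ0, hg0, ?_⟩
    by_contra hS
    push Not at hS
    obtain ⟨hS1, hS2⟩ := hS
    obtain ⟨i, hi⟩ := hS1
    obtain ⟨j, hj⟩ : ∃ j, j ∉ S' := by
      by_contra h; push Not at h; exact hS2 (eq_univ_of_forall h)
    have hij : i ≠ j := fun h => hj (h ▸ hi)
    -- the point lighting monomials `i` and `j`
    set x : Fin N → ZMod 2 := fun w => if w = p i ∨ w = q i ∨ w = p j ∨ w = q j then 1 else 0 with hx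
    have hxp : ∀ l, l ≠ i → l ≠ j → x (p l) = 0 := fun l hli hlj => by
      rw [hx]; refine if_neg ?_
      rintro (h | h | h | h); exacts [hli (hp h), hpq l i h, hlj (hp h), hpq l j h]
    have hxi : x (p i) * x (q i) = 1 := by rw [hx]; simp
    have hxj : x (p j) * x (q j) = 1 := by rw [hx]; simp
    have hmx : msum p q x = 0 := by
      unfold msum
      rw [Fintype.sum_eq_add i j hij (fun l hl => by rw [hxp l hl.1 hl.2, zero_mul]), hxi, hxj, CharTwo.add_self_eq_zero]
    have h1 := hκ x hmx
    have h0 := hκ 0 hms0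
    rw [pshape_eq, hΛ0, hg0, sum_empty, Finset.sum_eq_single_of_mem i hi (fun l hl hli => by
      rw [hxp l hli (fun h => hj (h ▸ hl)), zero_mul]), hxi] at h1
    rw [pshape_eq, hΛ0, hg0, sum_empty] at h0
    simp only [cval, add_zero, Pi.zero_apply, mul_zero, sum_const_zero] at h0 h1
    rw [h0] at h1
    exact one_ne_zero ((add_eq_left).1 h1)
  · ------------------------------------------------------------------ v = 1
    rcases Nat.lt_or_ge k 2 with hk | hk
    · interval_cases k
      · exfalso; unfold msum at hx₀; simp at hx₀
      · exact Or.inr (Or.inr ⟨rfl, rfl⟩)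
    -- k ≥ 2: the lit points `pt j` lie on the level set
    have hpt : ∀ j, msum p q (pt p q j) = 1 := msum_pt hp hpq
    have KEY : ∀ (j : Fin k) (w : Fin N), ¬ (w = p j ∨ w = q j) →
        (if w ∈ Λ then (1 : ZMod 2) else 0) + cflip g w (pt p q j) = 0 :=
      fun j w hw => key _ w (hpt j) (dark_pt hq hp hpq j hw)
    have hex : ∀ i : Fin k, ∃ j, j ≠ i := fun i => by
      by_contra h; push Not at h
      have : (univ : Finset (Fin k)).card ≤ 1 := card_le_one.2 fun a _ b _ => (h a).trans (h b).symm
      rw [card_univ, Fintype.card_fin] at this; omega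
    rcases hg' : g with _ | ⟨a, b⟩
    · ---------------------------------------------------------------- no carrier
      left
      have hΛ0 : Λ = ∅ := by
        refine eq_empty_of_forall_notMem fun w hw => ?_
        obtain ⟨i, hi⟩ := hmv (hΛ hw)
        obtain ⟨j, hji⟩ := hex i
        have h := KEY j w (not_mem_of_ne hp hq hpq (Ne.symm hji) hi)
        rw [hg'] at h
        simp only [cflip, add_zero, if_pos hw] at h
        exact one_ne_zero h
      refine ⟨hΛ0, rfl, empty_or_univ fun i j hi => ?_⟩
      have h1 := hκ _ (hpt i)
      have h2 := hκ _ (hpt j)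
      rw [pshape_eq, hg', hΛ0, sum_empty, sumS_pt hp hpq, if_pos hi] at h1
      rw [pshape_eq, hg', hΛ0, sum_empty, sumS_pt hp hpq] at h2
      by_contra hj
      rw [if_neg hj] at h2
      simp only [cval, add_zero] at h1 h2
      rw [← h2] at h1
      exact one_ne_zero ((add_eq_left).1 h1)
    · ---------------------------------------------------------------- carrier (a, b)
      obtain ⟨ha, hb, hab, hmon⟩ := hg a b hg'
      obtain ⟨ia, hia⟩ := hmv ha
      obtain ⟨ib, hib⟩ := hmv hb
      have hne : ia ≠ ib := by
        intro h
        rw [← h] at hib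
        apply hmon ia
        rcases hia with rfl | rfl <;> rcases hib with h' | h'
        exacts [absurd h'.symm hab, by rw [h'], by rw [h', pair_comm], absurd h'.symm hab]
      have haT : ¬ (a = p ib ∨ a = q ib) := not_mem_of_ne hp hq hpq hne hia
      have hbT : ¬ (b = p ia ∨ b = q ia) := not_mem_of_ne hp hq hpq (Ne.symm hne) hib
      -- flip `a` at `pt ib`: `a ∈ Λ`
      have haΛ : a ∈ Λ := by
        have h := KEY ib a haT
        by_contra haΛ
        rw [hg', if_neg haΛ] at h
        simp only [cflip, pt_of_mem p q hib, if_neg (Ne.symm hab)] at h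
        norm_num at h
      have hbΛ : b ∈ Λ := by
        have h := KEY ia b hbT
        by_contra hbΛ
        rw [hg', if_neg hbΛ] at h
        simp only [cflip, pt_of_mem p q hia, if_neg hab] at h
        norm_num at h
      -- no third monomial: every index is `ia` or `ib`, so `k = 2`
      have hidx : ∀ l : Fin k, l = ia ∨ l = ib := by
        intro l; by_contra h; push Not at h
        have h' := KEY l a (not_mem_of_ne hp hq hpq (Ne.symm h.1) hia)
        rw [hg'] at h'
        simp only [cflip, if_pos haΛ, if_neg (Ne.symm hab),
          pt_of_not_mem p q (not_mem_of_ne hp hq hpq (Ne.symm h.2) hib), add_zero] at h'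
        exact one_ne_zero h'
      have hk2 : k = 2 := by
        have hsub : (univ : Finset (Fin k)) ⊆ {ia, ib} := fun l _ => by rw [mem_insert, mem_singleton]; exact hidx l
        have := card_le_card hsub
        rw [card_univ, Fintype.card_fin, card_pair hne] at this; omega
      -- the co-variables are not read
      have hco : ∀ {i j : Fin k} {d d' e : Fin N}, i ≠ j → (d = p i ∨ d = q i) → (d' = p i ∨ d' = q i) → d' ≠ d →
          (e = p j ∨ e = q j) → (g = some (d, e) ∨ g = some (e, d)) → d' ∉ Λ := by
        intro i j d d' e hij hd hd' hd'd he hge hd'Λ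
        have h := KEY j d' (not_mem_of_ne hp hq hpq hij hd')
        have hed' : e ≠ d' := fun h' => not_mem_of_ne hp hq hpq hij hd' (h' ▸ he)
        rcases hge with hge | hge <;> rw [hge] at h <;>
          simp only [cflip, if_pos hd'Λ, if_neg hd'd.symm, if_neg hed', add_zero] at h <;> exact one_ne_zero h
      -- co-variable of `a` in monomial `ia`, of `b` in `ib`
      obtain ⟨a', ha', ha'a⟩ : ∃ a', (a' = p ia ∨ a' = q ia) ∧ a' ≠ a := by
        rcases hia with h | h
        · exact ⟨q ia, Or.inr rfl, fun h' => hpq ia ia (h.symm.trans h'.symm)⟩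
        · exact ⟨p ia, Or.inl rfl, fun h' => hpq ia ia (h'.trans h)⟩
      obtain ⟨b', hb', hb'b⟩ : ∃ b', (b' = p ib ∨ b' = q ib) ∧ b' ≠ b := by
        rcases hib with h | h
        · exact ⟨q ib, Or.inr rfl, fun h' => hpq ib ib (h.symm.trans h'.symm)⟩
        · exact ⟨p ib, Or.inl rfl, fun h' => hpq ib ib (h'.trans h)⟩
      have ha'Λ : a' ∉ Λ := hco hne hia ha' ha'a hib (Or.inl hg')
      have hb'Λ : b' ∉ Λ := hco (Ne.symm hne) hib hb' hb'b hia (Or.inr hg')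
      have hmon2 : ∀ {i : Fin k} {d d' w : Fin N}, (d = p i ∨ d = q i) → (d' = p i ∨ d' = q i) → d' ≠ d → (w = p i ∨ w = q i) →
          w = d ∨ w = d' := by
        intro i d d' w hd hd' hdd hw
        rcases hd with rfl | rfl <;> rcases hd' with rfl | rfl <;> rcases hw with rfl | rfl <;> tauto
      have hΛab : Λ = {a, b} := by
        ext w
        rw [mem_insert, mem_singleton]
        constructor
        · intro hw
          obtain ⟨l, hl⟩ := hmv (hΛ hw)
          rcases hidx l with rfl | rfl
          · rcases hmon2 hia ha' ha'a hl with rfl | rfl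
            · exact Or.inl rfl
            · exact absurd hw ha'Λ
          · rcases hmon2 hib hb' hb'b hl with rfl | rfl
            · exact Or.inr rfl
            · exact absurd hw hb'Λ
        · rintro (rfl | rfl); exacts [haΛ, hbΛ]
      -- the two lit points equalise `S'`
      have hval : ∀ {i j : Fin k} {d e : Fin N}, i ≠ j → (d = p i ∨ d = q i) → (e = p j ∨ e = q j) → Λ = {d, e} → d ≠ e →
          (g = some (d, e) ∨ g = some (e, d)) → pshape p q c S' Λ g (pt p q i) = c + (if i ∈ S' then 1 else 0) + 1 := by
        intro i j d e hij hd he hΛde hde hge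
        have hept : pt p q i e = 0 := pt_of_not_mem p q (not_mem_of_ne hp hq hpq (Ne.symm hij) he)
        rw [pshape_eq, sumS_pt hp hpq, hΛde, sum_pair hde, pt_of_mem p q hd, hept, add_zero]
        rcases hge with hge | hge <;> rw [hge] <;> simp only [cval, hept, mul_zero, zero_mul, add_zero]
      have hS : S' = ∅ ∨ S' = univ := by
        have h1 := hκ _ (hpt ia)
        have h2 := hκ _ (hpt ib)
        rw [hval hne hia hib hΛab hab (Or.inl hg')] at h1
        rw [hval (Ne.symm hne) hib hia (by rw [hΛab, pair_comm]) (Ne.symm hab) (Or.inr hg')] at h2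
        rw [← h2] at h1
        have hiff : ia ∈ S' ↔ ib ∈ S' := by
          by_cases h : ia ∈ S' <;> by_cases h' : ib ∈ S' <;> simp only [h, h', if_true, if_false] at h1 ⊢ <;>
            first | exact Iff.rfl | (exfalso; revert h1; generalize c = t; fin_cases t <;> decide)
        by_cases h : ia ∈ S'
        · refine Or.inr (eq_univ_of_forall fun l => ?_)
          rcases hidx l with rfl | rfl; exacts [h, hiff.1 h]
        · refine Or.inl (eq_empty_of_forall_notMem fun l hl => ?_)
          rcases hidx l with rfl | rfl; exacts [h hl, h (hiff.2 hl)]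
      exact Or.inr (Or.inl ⟨hk2, rfl, hS, a, b, rfl, hΛab, ia, ib, hne, hia, hib⟩)

end Summit.PneNP.PneNP.Theorems.PstarLemmaAlpha
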